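import Literature.AlgebraicGeometry.GroupSchemes.ReductionKernelKilledByN
import Mathlib.AlgebraicGeometry.Gluing
import HarnessLib

/-!
# Drinfeld's rigidity lemma, first-order case, over an ARBITRARY test scheme: a point of a monoid scheme which is the unit on a
# base change of the square-zero thickening `Spec (A⧸J) ↪ Spec A` is killed by `N` ([Katz1981SerreTate] §1.1 Lemmas 1.1.1–1.1.2)

Topic `Literature/AlgebraicGeometry/GroupSchemes`, namespace `Literature.AlgebraicGeometry.GroupSchemes.ReductionKernel`.
THEOREMS ONLY (no definition, no named fact, no instance, no notation, no `sorry`).  Sequel of ★ `ReductionKernelKilledByN`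
(F0P6-p11 (g0): `pow_eq_one_of_forall_mul_eq_zero` — over a LOCAL ring `A`, a point `y ∈ Y(Spec B)` of a monoid scheme `Y` which is
the unit on a square-zero closed subscheme `Spec B₀ ↪ Spec B` is killed by every `N` killing `ker (B → B₀)`), which lists among its
sequels «the non-affine test scheme ∕ base-change-square form (`IsBaseChangeVia` currency of the P6b line)».  THIS FILE is that form,
the shape consumed by ★ `AbelianSchemes/SerreTateCanonicalLift` (binder `hK`) and by Serre–Tate full faithfulness:

* **`pow_eq_one_of_isPullback`** — `A` local, `J ⊆ A` with `J² = 0` and `N · J = 0` (e.g. `𝔪_A · J = 0` and `N ∈ 𝔪_A`); `Y` a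
  monoid object of `Over (Spec A)`; `W` ANY `Spec A`-scheme with a cartesian square `(ρ : W₀ → W, b : W₀ → Spec (A⧸J))` over
  `Spec (A⧸J) ↪ Spec A`; then every `q ∈ Y(W)` with `ρ ≫ q = ρ ≫ 1` satisfies `q ^ N = 1`.  Proof: on an affine chart
  `Spec R → W` (structure map `φ : A → R`) the thickening `Spec (R⧸J·R) ↪ Spec R` factors through `ρ` (cartesian square), so the
  restricted point is the unit on `Spec (R⧸J·R)`; `(J·R)² = 0` and `N · (J·R) = 0`; ★ `pow_eq_one_of_forall_mul_eq_zero` kills it;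
  morphisms into `Y` agree when they agree on an open cover (Mathlib `Scheme.Cover.hom_ext`).

Cell `pub/hodgecm-mathlib` (D-0151 ∕ D-0183 floor 0), P6 Row 4B, organ (O1g) of F0P6-p12 (g0) over F0P6-p11 (g0)'s (O1); generic,
count-neutral capital `--supports stmt-HodgeConjecture-24832`.  HC_CM is proved only modulo the printed citations until rung 0 closes.

## References
* [Katz1981SerreTate] N. M. Katz, *Serre–Tate local moduli*, LNM 868 (1981), exp. Vbis, §1.1 Lemmas 1.1.1–1.1.2 (pp. 138–140).
* [GortzWedhorn2023] U. Görtz, T. Wedhorn, *Algebraic Geometry II* (2023), Remark 27.18 (3)–(4).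
-/

noncomputable section

set_option backward.isDefEq.respectTransparency false

universe u

open CategoryTheory CategoryTheory.Limits AlgebraicGeometry MonoidalCategory CartesianMonoidalCategory
open scoped MonObj

namespace Literature.AlgebraicGeometry.GroupSchemes.ReductionKernel

variable {A : Type u} [CommRing A] [IsLocalRing A] {J : Ideal A} {Y : Over (Spec (CommRingCat.of A))} [MonObj Y]

/-- **Drinfeld's rigidity lemma, first-order case, base-change-square form** ([Katz1981SerreTate] §1.1 Lemmas 1.1.1–1.1.2,
`ν = 1`): `A` local, `J² = 0`, `N · J = 0`; `Y` a monoid scheme over `Spec A`; `W` any `Spec A`-scheme with a CARTESIAN square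
`(ρ : W₀ → W, b : W₀ → Spec (A⧸J))` over the thickening `Spec (A⧸J) ↪ Spec A`.  Every `W`-point `q` of `Y` which is the unit
on `W₀` (`ρ ≫ q = ρ ≫ 1` on underlying schemes) satisfies `q ^ N = 1`.  (Zariski-local on `W`: on an affine chart `Spec R → W` the
square-zero thickening `Spec (R⧸J·R) ↪ Spec R` factors through `ρ`, and ★ `pow_eq_one_of_forall_mul_eq_zero` applies with
`N · (J·R) = 0`.) [cite: Katz1981SerreTate, §1.1 Lemmas 1.1.1–1.1.2] [cite: GortzWedhorn2023, Remark 27.18 (3)–(4)] -/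
theorem pow_eq_one_of_isPullback (hJ : J * J = ⊥) {N : ℕ} (hN : ∀ a ∈ J, (N : A) * a = 0)
    {W : Over (Spec (CommRingCat.of A))} {W₀ : Scheme.{u}} (ρ : W₀ ⟶ W.left) (b : W₀ ⟶ Spec (.of (A ⧸ J)))
    (hρ : IsPullback ρ b W.hom (Spec.map (CommRingCat.ofHom (Ideal.Quotient.mk J))))
    (q : W ⟶ Y) (hq : ρ ≫ q.left = ρ ≫ (1 : W ⟶ Y).left) : q ^ N = 1 := by
  let 𝒰 := W.left.affineCover
  -- equality of `S`-morphisms is checked on underlying schemes, Zariski-locally on `W`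
  apply Over.OverMorphism.ext
  refine Scheme.Cover.hom_ext 𝒰 _ _ fun c => ?_
  -- the chart `m : Spec R → W`, its structure map `φ : A → R`
  let R : CommRingCat.{u} := W.left.affineOpenCover.X c
  let m : Spec R ⟶ W.left := 𝒰.f c
  let φ : A →+* R := (Spec.preimage (m ≫ W.hom)).hom
  letI : Algebra A R := φ.toAlgebra
  have hm : m ≫ W.hom = Spec.map (CommRingCat.ofHom (algebraMap A R)) := by
    change m ≫ W.hom = Spec.map (CommRingCat.ofHom φ)
    rw [CommRingCat.ofHom_hom, Spec.map_preimage]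
  let mO : Over.mk (Spec.map (CommRingCat.ofHom (algebraMap A R))) ⟶ W := Over.homMk m hm
  -- the thickening `Spec (R ⧸ J·R) ↪ Spec R`: square-zero, killed by `N`
  let π : (R : Type u) →+* (R ⧸ J.map (algebraMap A R)) := Ideal.Quotient.mk _
  have hπ2 : RingHom.ker π ^ 2 = ⊥ := by
    rw [Ideal.mk_ker, pow_two, ← Ideal.map_mul, hJ, Ideal.map_bot]
  have hNπ : ∀ r, π r = 0 → (N : R) * r = 0 := by
    intro r hr
    rw [Ideal.Quotient.eq_zero_iff_mem] at hr
    have key : J.map (algebraMap A R) ≤ LinearMap.ker (LinearMap.mulLeft R (N : R)) := by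
      rw [Ideal.map_le_iff_le_comap]
      intro a ha
      change (N : R) * algebraMap A R a = 0
      rw [← map_natCast (algebraMap A R), ← map_mul, hN a ha, map_zero]
    exact key hr
  -- it factors through `ρ` (the square is cartesian), so `mO ≫ q` is the unit on it
  have w : (Spec.map (CommRingCat.ofHom π) ≫ m) ≫ W.hom =
      Spec.map (CommRingCat.ofHom (Ideal.quotientMap (J.map (algebraMap A R)) (algebraMap A R) Ideal.le_comap_map)) ≫
        Spec.map (CommRingCat.ofHom (Ideal.Quotient.mk J)) := by
    rw [Category.assoc, hm, ← Spec.map_comp, ← Spec.map_comp, ← CommRingCat.ofHom_comp, ← CommRingCat.ofHom_comp,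
      Ideal.quotientMap_comp_mk]
  have hy : Spec.map (CommRingCat.ofHom π) ≫ (mO ≫ q).left =
      Spec.map (CommRingCat.ofHom π) ≫ (1 : Over.mk (Spec.map (CommRingCat.ofHom (algebraMap A R))) ⟶ Y).left := by
    rw [← MonObj.comp_one mO, Over.comp_left, Over.comp_left]
    change Spec.map (CommRingCat.ofHom π) ≫ m ≫ q.left = Spec.map (CommRingCat.ofHom π) ≫ m ≫ (1 : W ⟶ Y).left
    rw [← Category.assoc, ← Category.assoc (Spec.map _) m, ← hρ.lift_fst _ _ w, Category.assoc, Category.assoc, hq]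
  have h := pow_eq_one_of_forall_mul_eq_zero (Y := Y) π Ideal.Quotient.mk_surjective hπ2 hNπ (mO ≫ q) hy
  rw [← MonObj.comp_pow, ← MonObj.comp_one mO] at h
  exact congrArg Over.Hom.left h

end Literature.AlgebraicGeometry.GroupSchemes.ReductionKernel

end
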